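/-
Copyright (c) 2026 the pub-hodgecm-mathlib formalisation cell (harness21).  Prover seat hodgecm-mathlib-K2E3-p21 (g4), Track B «K2-LIT» ∕ h413
(`stmt-HodgeConjecture-24833`), line `K2_E3_EllipticInputs`, unit U12 §L, Richardson road for (LBGL-ge3) at `N = 3` (road owner K2E3-p11 (g4), deal (F-E)-A′
2026-09-04T05:21Z): «THE `𝔫_𝔭`-TWIST OF THE (2,1) PARABOLIC OF `𝔤𝔩₃(F)` AT A BLOCK-REGULAR LEVI ELEMENT».  2026-09-04.
-/
import Summits.HodgeConjecture.HodgeConjecture.Theorems.K2E3GL3MinimalRichardsonFourier   -- ★ p857528 (K2E3-p11 g4): `exists_haar_eq_smul_map_box` (Haar on `U_c` = `C • Φ_* dx^{box}`)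
import Literature.MeasureTheory.Group.LocalFieldLinearJacobian                             -- ★ `lintegral_comp_linearEquiv` (`∫ f∘L = ‖det L‖⁻¹ ∫ f` on `Fᵈ`)
import Literature.NumberTheory.Automorphic.LocalRingUnitModulusProduct                      -- ★ `UnitaryGroup.distribHaarChar_eq_normAbs`
import HarnessLib

/-!
# K2_E3 road (h413), §L — Richardson road for (LBGL-ge3) at `N = 3`, brick (F-E)-A′: the `𝔫_𝔭`-twist of the maximal parabolic `𝔭 = 𝔭_{(2,1)} ⊂ 𝔤𝔩₃(F)`
# `∫_{U_𝔭} φ(u · M · u⁻¹) dμ_U = C · |χ_A(b)|⁻¹ · ∫_{F²} φ(M + [[0,0,y₀],[0,0,y₁],[0,0,0]]) dy` for `M = diag-block(A, b)` with `χ_A(b) ≠ 0`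

Cell `pub/hodgecm-mathlib` (D-0151), Track B, seat K2E3-p21 (g4); road owner K2E3-p11 (g4) (05:21:40Z: «(F-E)-A′ … state it in `lintegral` form like p20's A1»), §L lead
K2E3-p12 (g4), dealer K2E3-plan (g3).  `--supports stmt-HodgeConjecture-24833 --as helper`; THEOREMS ONLY (no definition ∕ instance ∕ notation ∕ named fact ∕ `sorry`); never
imports `Cruxes/…/Lines`.  COUNT-NEUTRAL ((LBGL-ge3) stays OPEN).  The (2,1)-parabolic twin of ★ p20 (g5)'s (F-J) brick A `K2E3GL3LieUnipotentTwist.lintegral_conj_diagonal_eq`.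

THE MATHEMATICS.  `U = U_𝔭 = unipotentRadicalGL F ![false,false,true] = {1 + X : X = [[0,0,x₀],[0,0,x₁],[0,0,0]]}`, `M(m) = [[m₀,m₁,0],[m₂,m₃,0],[0,0,m₄]]`
(`A = [[m₀,m₁],[m₂,m₃]]`, `b = m₄`).  Since `X² = 0` and `X M X = 0`: `(1+X) M (1−X) = M + (XM − MX) = M + [[0,0,y₀],[0,0,y₁],[0,0,0]]` with `y = (b·1 − A) x`, a
LINEAR map of `F²` with determinant `det(b − A) = χ_A(b)`.  With ★ `exists_haar_eq_smul_map_box` (`μ_U = C₀ • Φ_*(dx ⊗ dx)` in the box chart), the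
reindexing `Fin 2 ≃ {i // cᵢ = false} × {j // cⱼ = true}` (measure preserving) and ★ `lintegral_comp_linearEquiv` (`∫ f(Ly) dy = ‖det L‖⁻¹ ∫ f`, ★
`distribHaarChar_eq_normAbs`) this gives the head `lintegral_conj_leviBlock_eq` with ONE constant `C₀ ∈ (0,∞)` independent of `m`.
[HarishChandra1999AdmissibleDistributions, §7 Lemma 7.8 (parabolic descent on the Lie algebra)]; [vanDijk1972, §2]; [Rogawski1990, §4.13 p. 70].

HONEST LABEL: HC_CM is proved only modulo the 7 printed citations (2 remaining named inputs: hLiu418 = stmt-HodgeConjecture-24832, h413 = stmt-HodgeConjecture-24833)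
until rung 0 closes; count-neutral helper.

References: [HarishChandra1999AdmissibleDistributions] Harish-Chandra (DeBacker–Sally), AMS ULECT 16 (1999), §7 Lemma 7.8 · [Rogawski1990] J. D. Rogawski, Ann. of
Math. Stud. 123 (1990), §4.13 p. 70 · [BernsteinZelevinsky1977] Ann. Sci. ÉNS 10 (1977), §2.1.
-/

set_option autoImplicit false
set_option linter.dupNamespace false   -- `Summit.HodgeConjecture.HodgeConjecture.…` (D-0017 nested layout; lakefile exemption for Summits)

noncomputable section

open MeasureTheory MeasureTheory.Measure Filter Topology TopologicalSpace Polynomial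
open scoped MatrixGroups NNReal ENNReal
open Literature.NumberTheory.Automorphic
open Literature.NumberTheory.GaloisRepresentations Literature.NumberTheory.GaloisRepresentations.IsNonarchimedeanLocalField
open Summit.HodgeConjecture.HodgeConjecture.Cruxes.H413.K2E3GL3MinimalRichardsonFourier

namespace Summit.HodgeConjecture.HodgeConjecture.Cruxes.H413.K2E3GL3ParabolicNilTwist

/-! ## §1  Algebra: the box index set of `c = (f,f,t)`, the chart matrix `1 + X(r)`, and `(1 + X) M (1 − X) = M + [[0,0,y],…]`, `y = (b − A) r` -/

section Algebra

variable {R : Type*} [CommRing R]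

/-- The box `{i // cᵢ = false} × {j // cⱼ = true}` of the labelling `c = (false, false, true)` is `Fin 2` (`k ↦ (k, 2)`). [folklore] -/
theorem boxEquiv_exists : ∃ e : Fin 2 ≃ ({i : Fin 3 // (![false, false, true] : Fin 3 → Bool) i = false} × {j : Fin 3 // (![false, false, true] : Fin 3 → Bool) j = true}),
    (e 0 = (⟨0, rfl⟩, ⟨2, rfl⟩)) ∧ (e 1 = (⟨1, rfl⟩, ⟨2, rfl⟩)) := by
  let f : Fin 2 → ({i : Fin 3 // (![false, false, true] : Fin 3 → Bool) i = false} × {j : Fin 3 // (![false, false, true] : Fin 3 → Bool) j = true}) :=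
    fun k => Fin.cases (⟨0, rfl⟩, ⟨2, rfl⟩) (fun _ => (⟨1, rfl⟩, ⟨2, rfl⟩)) k
  exact ⟨Equiv.ofBijective f (by decide), rfl, rfl⟩

/-- `χ_A(b) = (b − m₀)(b − m₃) − m₁ m₂ = det (b·1 − A)` for `A = [[m₀,m₁],[m₂,m₃]]`. [folklore] -/
theorem eval_charpoly_fin_two (m : Fin 5 → R) :
    (!![m 0, m 1; m 2, m 3] : Matrix (Fin 2) (Fin 2) R).charpoly.eval (m 4) = (m 4 - m 0) * (m 4 - m 3) - m 1 * m 2 := by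
  rw [Matrix.eval_charpoly, Matrix.det_fin_two]
  simp [Matrix.scalar_apply, Matrix.diagonal]

/-- The twist matrix `P = b·1 − A = [[m₄ − m₀, −m₁],[−m₂, m₄ − m₃]]` has `det P = χ_A(m₄)`. [folklore] -/
theorem det_twistMatrix (m : Fin 5 → R) :
    (!![m 4 - m 0, -(m 1); -(m 2), m 4 - m 3] : Matrix (Fin 2) (Fin 2) R).det = (!![m 0, m 1; m 2, m 3] : Matrix (Fin 2) (Fin 2) R).charpoly.eval (m 4) := by
  rw [eval_charpoly_fin_two, Matrix.det_fin_two]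
  simp

/-- `P *ᵥ r` for the twist matrix. [folklore] -/
theorem twistMatrix_mulVec (m : Fin 5 → R) (r : Fin 2 → R) :
    Matrix.mulVec (!![m 4 - m 0, -(m 1); -(m 2), m 4 - m 3] : Matrix (Fin 2) (Fin 2) R) r = ![(m 4 - m 0) * r 0 - m 1 * r 1, -(m 2 * r 0) + (m 4 - m 3) * r 1] := by
  funext k
  fin_cases k <;> simp [Matrix.mulVec, dotProduct, Fin.sum_univ_two]
  ring

/-- **`(1 + X) · M · (1 − X) = M + N(P r)`** for `X = N(r) = [[0,0,r₀],[0,0,r₁],[0,0,0]]`, `M = M(m)`, `P = m₄·1 − A` (`X² = 0`, `X M X = 0`). [cite: Rogawski1990, §4.13 p. 70] -/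
theorem chart_mul_leviBlock_mul_chartInv (m : Fin 5 → R) (r : Fin 2 → R) :
    (!![1, 0, r 0; 0, 1, r 1; 0, 0, 1] : Matrix (Fin 3) (Fin 3) R) * !![m 0, m 1, 0; m 2, m 3, 0; 0, 0, m 4] * !![1, 0, -(r 0); 0, 1, -(r 1); 0, 0, 1] =
      !![m 0, m 1, 0; m 2, m 3, 0; 0, 0, m 4] + !![0, 0, ((m 4 - m 0) * r 0 - m 1 * r 1); 0, 0, (-(m 2 * r 0) + (m 4 - m 3) * r 1); 0, 0, 0] := by
  ext i j
  fin_cases i <;> fin_cases j <;> simp [Matrix.mul_apply, Fin.sum_univ_three] <;> ring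

/-- `(1 + X)(1 − X) = 1`. [folklore] -/
theorem chart_mul_chartNeg (r : Fin 2 → R) :
    (!![1, 0, r 0; 0, 1, r 1; 0, 0, 1] : Matrix (Fin 3) (Fin 3) R) * !![1, 0, -(r 0); 0, 1, -(r 1); 0, 0, 1] = 1 := by
  ext i j
  fin_cases i <;> fin_cases j <;> simp [Matrix.mul_apply, Fin.sum_univ_three]

end Algebra

/-! ## §2  The head: `∫_{U_𝔭} φ(Ad(u) M(m)) dμ_U = C · |χ_A(m₄)|⁻¹ · ∫_{F²} φ(M(m) + N(y)) dy` -/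

section Twist

variable (F : Type*) [Field F] [ValuativeRel F] [TopologicalSpace F] [IsNonarchimedeanLocalField F]
  [MeasurableSpace F] [BorelSpace F] [MeasurableSpace (GL (Fin 3) F)] [BorelSpace (GL (Fin 3) F)]
  [MeasurableSpace (Matrix (Fin 3) (Fin 3) F)] [BorelSpace (Matrix (Fin 3) (Fin 3) F)]

/-- **(F-E)-A′ THE `𝔫_𝔭`-TWIST AT A BLOCK-REGULAR LEVI ELEMENT, AS AN INTEGRAL FORMULA.**  `μ_U` a Haar measure on the unipotent radical
`U = U_{(2,1)} = unipotentRadicalGL F ![false,false,true] ≤ GL₃(F)`, `dx` an additive Haar measure on `F`.  There is ONE `C ∈ (0, ∞)` such that for every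
`m : Fin 5 → F` with `χ_A(m₄) ≠ 0` (`A = [[m₀,m₁],[m₂,m₃]]`) and every Borel `φ : 𝔤𝔩₃(F) → [0, ∞]`:
**`∫⁻_U φ(u · M(m) · u⁻¹) dμ_U = C · |χ_A(m₄)|_F⁻¹ · ∫⁻_{F²} φ(M(m) + [[0,0,y₀],[0,0,y₁],[0,0,0]]) d(dx ⊗ dx)`**, `M(m) = [[m₀,m₁,0],[m₂,m₃,0],[0,0,m₄]]` —
`u ↦ Ad(u)M − M` pushes `μ_U` to `|χ_A(m₄)|⁻¹` times the Lebesgue measure of `𝔫_𝔭` (the linear map `y = (m₄·1 − A) x`).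
[cite: HarishChandra1999AdmissibleDistributions, §7 Lemma 7.8] [cite: Rogawski1990, §4.13 p. 70] -/
theorem lintegral_conj_leviBlock_eq (μU : Measure ↥(unipotentRadicalGL F (![false, false, true] : Fin 3 → Bool))) [IsHaarMeasure μU]
    (dx : Measure F) [dx.IsAddHaarMeasure] :
    ∃ C : ℝ≥0∞, C ≠ 0 ∧ C ≠ ∞ ∧ ∀ m : Fin 5 → F, (!![m 0, m 1; m 2, m 3] : Matrix (Fin 2) (Fin 2) F).charpoly.eval (m 4) ≠ 0 →
      ∀ φ : Matrix (Fin 3) (Fin 3) F → ℝ≥0∞, Measurable φ →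
        ∫⁻ u : ↥(unipotentRadicalGL F (![false, false, true] : Fin 3 → Bool)),
            φ (((u : GL (Fin 3) F) : Matrix (Fin 3) (Fin 3) F) * !![m 0, m 1, 0; m 2, m 3, 0; 0, 0, m 4] *
              (((u : GL (Fin 3) F)⁻¹ : GL (Fin 3) F) : Matrix (Fin 3) (Fin 3) F)) ∂μU =
          C * ((normAbs F ((!![m 0, m 1; m 2, m 3] : Matrix (Fin 2) (Fin 2) F).charpoly.eval (m 4)))⁻¹ : ℝ≥0) *
            ∫⁻ y : Fin 2 → F, φ (!![m 0, m 1, 0; m 2, m 3, 0; 0, 0, m 4] + !![0, 0, y 0; 0, 0, y 1; 0, 0, 0]) ∂(Measure.pi fun _ : Fin 2 => dx) := by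
  classical
  haveI : T2Space F := (isLocalField F).toT2Space
  haveI : LocallyCompactSpace F := (isLocalField F).toLocallyCompactSpace
  haveI : SecondCountableTopology F := secondCountableTopology_localField F
  haveI : IsTopologicalRing F := inferInstance
  haveI : BorelSpace ↥(unipotentRadicalGL F (![false, false, true] : Fin 3 → Bool)) := Subtype.borelSpace _
  haveI : SFinite dx := inferInstance
  -- the box chart of `U` (★ p857528) and the reindexing `Fin 2 ≃ box`
  obtain ⟨Φ, hΦ, C₀, hC₀, hμU⟩ := exists_haar_eq_smul_map_box (F := F) (c := (![false, false, true] : Fin 3 → Bool)) dx μU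
  obtain ⟨e, he0, he1⟩ := boxEquiv_exists
  set ε := MeasurableEquiv.piCongrLeft (fun _ : {i : Fin 3 // (![false, false, true] : Fin 3 → Bool) i = false} ×
    {j : Fin 3 // (![false, false, true] : Fin 3 → Bool) j = true} => F) e with hεdef
  have hε : MeasurePreserving ε (Measure.pi fun _ : Fin 2 => dx) (Measure.pi fun _ => dx) := by
    rw [hεdef]; exact measurePreserving_piCongrLeft (fun _ => dx) e
  -- the chart matrix at `ε r` is `[[1,0,r₀],[0,1,r₁],[0,0,1]]`
  have hεapp : ∀ (r : Fin 2 → F) (k : Fin 2), ε r (e k) = r k := fun r k => by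
    rw [hεdef]; exact MeasurableEquiv.piCongrLeft_apply_apply (β := fun _ => F) e r k
  have hcoe : ∀ r : Fin 2 → F, (((Φ (ε r) : ↥(unipotentRadicalGL F (![false, false, true] : Fin 3 → Bool))) : GL (Fin 3) F) : Matrix (Fin 3) (Fin 3) F) =
      !![1, 0, r 0; 0, 1, r 1; 0, 0, 1] := fun r => by
    ext i j
    rw [hΦ]
    have h0 : ε r (⟨0, rfl⟩, ⟨2, rfl⟩) = r 0 := by rw [← he0]; exact hεapp r 0
    have h1 : ε r (⟨1, rfl⟩, ⟨2, rfl⟩) = r 1 := by rw [← he1]; exact hεapp r 1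
    fin_cases i <;> fin_cases j <;> simp [h0, h1]
  have hcoeinv : ∀ r : Fin 2 → F, ((((Φ (ε r) : ↥(unipotentRadicalGL F (![false, false, true] : Fin 3 → Bool))) : GL (Fin 3) F)⁻¹ : GL (Fin 3) F) :
      Matrix (Fin 3) (Fin 3) F) = !![1, 0, -(r 0); 0, 1, -(r 1); 0, 0, 1] := fun r => by
    rw [Matrix.coe_units_inv, hcoe]
    exact Matrix.inv_eq_right_inv (chart_mul_chartNeg r)
  refine ⟨(C₀ : ℝ≥0∞), ENNReal.coe_ne_zero.2 hC₀, ENNReal.coe_ne_top, fun m hχ φ hφ => ?_⟩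
  -- the twist matrix `P = m₄ − A` as a linear automorphism of `F²`
  set P : Matrix (Fin 2) (Fin 2) F := !![m 4 - m 0, -(m 1); -(m 2), m 4 - m 3] with hP
  have hPdet : P.det = (!![m 0, m 1; m 2, m 3] : Matrix (Fin 2) (Fin 2) F).charpoly.eval (m 4) := det_twistMatrix m
  have hPunit : IsUnit P.det := by rw [hPdet]; exact isUnit_iff_ne_zero.2 hχ
  set L : (Fin 2 → F) ≃ₗ[F] (Fin 2 → F) := P.toLinearEquiv' (Matrix.invertibleOfIsUnitDet P hPunit) with hL
  have hLapp : ∀ r, L r = Matrix.mulVec P r := fun r => by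
    show (L : Module.End F (Fin 2 → F)) r = _
    rw [hL, Matrix.toLinearEquiv'_apply, Matrix.toLin'_apply]
  have hLdet : ((LinearEquiv.det L : Fˣ) : F) = (!![m 0, m 1; m 2, m 3] : Matrix (Fin 2) (Fin 2) F).charpoly.eval (m 4) := by
    rw [LinearEquiv.coe_det, show (L : (Fin 2 → F) →ₗ[F] (Fin 2 → F)) = Matrix.toLin' P from rfl, LinearMap.det_toLin', hPdet]
  -- the target function on `F²`
  set G : (Fin 2 → F) → ℝ≥0∞ := fun y => φ (!![m 0, m 1, 0; m 2, m 3, 0; 0, 0, m 4] + !![0, 0, y 0; 0, 0, y 1; 0, 0, 0]) with hG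
  have hNc : Continuous fun y : Fin 2 → F => (!![m 0, m 1, 0; m 2, m 3, 0; 0, 0, m 4] + !![0, 0, y 0; 0, 0, y 1; 0, 0, 0] : Matrix (Fin 3) (Fin 3) F) := by
    refine continuous_const.add (continuous_matrix fun i j => ?_)
    fin_cases i <;> fin_cases j <;> simp <;> fun_prop
  have hGm : Measurable G := hφ.comp hNc.measurable
  -- STEP 1: `μ_U = C₀ • (Φ ∘ ε)_* (dx ⊗ dx)` and the pointwise identity `Ad(Φ(ε r)) M = M + N(P r)`
  have hmeas : Measurable fun u : ↥(unipotentRadicalGL F (![false, false, true] : Fin 3 → Bool)) =>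
      φ (((u : GL (Fin 3) F) : Matrix (Fin 3) (Fin 3) F) * !![m 0, m 1, 0; m 2, m 3, 0; 0, 0, m 4] * (((u : GL (Fin 3) F)⁻¹ : GL (Fin 3) F) : Matrix (Fin 3) (Fin 3) F)) :=
    hφ.comp (((Units.continuous_val.comp continuous_subtype_val).mul continuous_const).mul (Units.continuous_coe_inv.comp continuous_subtype_val)).measurable
  have hstep1 : ∫⁻ u : ↥(unipotentRadicalGL F (![false, false, true] : Fin 3 → Bool)),
      φ (((u : GL (Fin 3) F) : Matrix (Fin 3) (Fin 3) F) * !![m 0, m 1, 0; m 2, m 3, 0; 0, 0, m 4] * (((u : GL (Fin 3) F)⁻¹ : GL (Fin 3) F) : Matrix (Fin 3) (Fin 3) F)) ∂μU =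
      (C₀ : ℝ≥0∞) * ∫⁻ r : Fin 2 → F, G (Matrix.mulVec P r) ∂(Measure.pi fun _ : Fin 2 => dx) := by
    rw [hμU, lintegral_smul_measure, lintegral_map hmeas Φ.continuous.measurable, ENNReal.smul_def, smul_eq_mul,
      ← hε.lintegral_comp (f := fun x => φ ((((Φ x : ↥(unipotentRadicalGL F (![false, false, true] : Fin 3 → Bool))) : GL (Fin 3) F) : Matrix (Fin 3) (Fin 3) F) *
        !![m 0, m 1, 0; m 2, m 3, 0; 0, 0, m 4] *
        ((((Φ x : ↥(unipotentRadicalGL F (![false, false, true] : Fin 3 → Bool))) : GL (Fin 3) F)⁻¹ : GL (Fin 3) F) : Matrix (Fin 3) (Fin 3) F)))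
        (hmeas.comp Φ.continuous.measurable)]
    congr 1
    refine lintegral_congr fun r => ?_
    show φ _ = φ _
    rw [hcoe, hcoeinv, chart_mul_leviBlock_mul_chartInv, twistMatrix_mulVec]
    rfl
  -- STEP 2: the linear substitution `y = P r`
  have hstep2 : ∫⁻ r : Fin 2 → F, G (Matrix.mulVec P r) ∂(Measure.pi fun _ : Fin 2 => dx) =
      ((normAbs F ((!![m 0, m 1; m 2, m 3] : Matrix (Fin 2) (Fin 2) F).charpoly.eval (m 4)))⁻¹ : ℝ≥0) * ∫⁻ y, G y ∂(Measure.pi fun _ : Fin 2 => dx) := by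
    have h := Literature.MeasureTheory.Group.lintegral_comp_linearEquiv (Measure.pi fun _ : Fin 2 => dx) L G
    simp_rw [hLapp] at h
    rw [h, UnitaryGroup.distribHaarChar_eq_normAbs F (LinearEquiv.det L), hLdet, ENNReal.coe_inv ((map_ne_zero (normAbs F)).2 hχ)]
  rw [hstep1, hstep2, ← mul_assoc]

end Twist

end Summit.HodgeConjecture.HodgeConjecture.Cruxes.H413.K2E3GL3ParabolicNilTwist

end
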